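import Mathlib.Analysis.SpecialFunctions.Pow.Real
import Mathlib.Topology.UnitInterval
import HarnessLib

/-!
# Design (D) endgame, item D13 of the refuter's checklist: WHICH ENDPOINT serves the interval `[p/2, p]` for Kozma–Nitzan's two
# explicit parameter-dependent inequalities (Step III's seed bound is ANTItone in the density, Step II's count bound is monotone)

builds on p205010 (kernel theorem, internal audit signed; external expert review pending) — nothing in this file uses p205010.
Lane `prim-bschramm`, seat `prim-bschramm-p5` (gen 3; refuter, D-CHECKLIST-v2 D13 / objection 14:35Z to the constants order of the
(D) partial closure), helper file (`--supports stmt-CriticalPhenomena-4575`).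

The (D) endgame re-runs the construction at every `q ∈ [p/2, p]` with ONE set of scales.  The two inequalities of `KNLevels.TargetPropertyUP`
that mention the running density are hypotheses supplied by the instance: Step II's `1/(1-q)^{Δ N} ≤ δ · #levels` and Step III's
`(1 - q^{sB})^k ≤ δ` (`KNLevelsTargetPropertyUniformP.lean:52,54`).  As functions of `q` they move in OPPOSITE directions:
* `q ↦ 1/(1-q)^m` is monotone — a bound at the RIGHT endpoint `p` serves every `q ≤ p` (`stepII_bound_of_le`);
* `q ↦ (1-q^s)^k` is ANTItone — a bound at the LEFT endpoint `p/2` serves every `q ≥ p/2` (`stepIII_bound_of_le`), while a bound at `p`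
  does NOT serve `q < p` (`stepIII_bound_at_right_endpoint_fails`: `s = 1`, `k = 2`, `δ = 1/4`, `p = 1/2`, `q = 1/4`).
So `k` must be chosen once with `(1 - (p/2)^{sB})^k ≤ δ` and `#levels` once with `1/(1-p)^{Δ N} ≤ δ · #levels`; then `N = k · kitB` and every
planar scale downstream is `q`-free on the interval, which is what keeps the finite input family of `BoxProdZ2ConcInputs` sufficient at `q`.
[cite: KozmaNitzan2024, §4 Lemma 10, Step II (p. 18) and Step III (pp. 19–20)]
-/

noncomputable section

namespace Summit.CriticalPhenomena.PercolationContinuityZ3.Theorems.Transplant.SamePParam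

/-- **Step III's seed bound is antitone in the density**: for `0 ≤ q ≤ q'` (≤ 1), `(1 - q'^s)^k ≤ (1 - q^s)^k`.
[cite: KozmaNitzan2024, §4 Lemma 10 Step III (pp. 19–20)] -/
theorem one_sub_pow_pow_antitone {q q' : ℝ} (hq : 0 ≤ q) (hqq' : q ≤ q') (hq' : q' ≤ 1) (s k : ℕ) :
    (1 - q' ^ s) ^ k ≤ (1 - q ^ s) ^ k := by
  have h1 : q ^ s ≤ q' ^ s := pow_le_pow_left₀ hq hqq' s
  have h2 : q' ^ s ≤ 1 := pow_le_one₀ (hq.trans hqq') hq'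
  exact pow_le_pow_left₀ (by linarith) (by linarith) k

/-- **A Step-III bound at the LEFT endpoint serves the whole interval**: if `(1 - q₀^s)^k ≤ δ` and `q₀ ≤ q ≤ 1` then `(1 - q^s)^k ≤ δ`.
Use with `q₀ = p/2`. [cite: KozmaNitzan2024, §4 Lemma 10 Step III (pp. 19–20)] -/
theorem stepIII_bound_of_le {q₀ q δ : ℝ} (hq₀ : 0 ≤ q₀) (hq₀q : q₀ ≤ q) (hq1 : q ≤ 1) {s k : ℕ}
    (h : (1 - q₀ ^ s) ^ k ≤ δ) : (1 - q ^ s) ^ k ≤ δ :=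
  (one_sub_pow_pow_antitone hq₀ hq₀q hq1 s k).trans h

/-- The `unitInterval` form of `stepIII_bound_of_le` for the running density `q ∈ [p/2, p]` of the (D) endgame.
[cite: KozmaNitzan2024, §4 Lemma 10 Step III (pp. 19–20)] -/
theorem stepIII_bound_of_half_le (p q : unitInterval) {δ : ℝ} {s k : ℕ} (hpq : (p : ℝ) / 2 ≤ q)
    (h : (1 - ((p : ℝ) / 2) ^ s) ^ k ≤ δ) : (1 - (q : ℝ) ^ s) ^ k ≤ δ :=
  stepIII_bound_of_le (by have := p.2.1; positivity) hpq q.2.2 h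

/-- **Step II's count bound is monotone in the density**: for `q ≤ q' < 1`, `1/(1-q)^m ≤ 1/(1-q')^m`.
[cite: KozmaNitzan2024, §4 Lemma 10 Step II (p. 18)] -/
theorem one_div_one_sub_pow_mono {q q' : ℝ} (hqq' : q ≤ q') (hq' : q' < 1) (m : ℕ) :
    1 / (1 - q) ^ m ≤ 1 / (1 - q') ^ m := by
  have h0 : 0 < 1 - q' := by linarith
  have h1 : (1 - q') ^ m ≤ (1 - q) ^ m := pow_le_pow_left₀ h0.le (by linarith) m
  exact one_div_le_one_div_of_le (pow_pos h0 m) h1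

/-- **A Step-II bound at the RIGHT endpoint serves the whole interval**: if `1/(1-p)^m ≤ δ·L` and `q ≤ p < 1` then `1/(1-q)^m ≤ δ·L`.
[cite: KozmaNitzan2024, §4 Lemma 10 Step II (p. 18)] -/
theorem stepII_bound_of_le {q p δ L : ℝ} (hqp : q ≤ p) (hp1 : p < 1) {m : ℕ} (h : 1 / (1 - p) ^ m ≤ δ * L) :
    1 / (1 - q) ^ m ≤ δ * L :=
  (one_div_one_sub_pow_mono hqp hp1 m).trans h

/-- **The wrong endpoint for Step III** (witness for the refuter's objection of 14:35Z): with `s = 1`, `k = 2`, `δ = 1/4`, the bound holds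
at `p = 1/2` but fails at `q = 1/4 ∈ [p/2, p]`. [this work] -/
theorem stepIII_bound_at_right_endpoint_fails :
    (1 - (1 / 2 : ℝ) ^ 1) ^ 2 ≤ 1 / 4 ∧ ¬ (1 - (1 / 4 : ℝ) ^ 1) ^ 2 ≤ 1 / 4 := by
  constructor <;> norm_num

end Summit.CriticalPhenomena.PercolationContinuityZ3.Theorems.Transplant.SamePParam

end
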